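import Literature.Geometry.Riemannian.FourShrinkerCovariantCurvatureBoundedOf
import Literature.Geometry.Riemannian.ShrinkerLocalisedMaximumPrinciple
import Literature.Geometry.Lorentzian.CoordShrinkerRmDrift
import Literature.Geometry.Lorentzian.CoordShrinkerCovRmDrift
import Literature.Geometry.Lorentzian.CoordShrinkerCovRmNormSqDrift
import HarnessLib

/-!
# Munteanu–Wang 2015, Thm. 1.4 (second half): `|∇Rm|` is bounded on a complete four-dimensional
# gradient shrinking Ricci soliton with bounded scalar curvature

**Theorem** (O. Munteanu, J. Wang, *Geometry of shrinking Ricci solitons*, Compositio Math. 151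
(2015), Thm. 1.4, p. 6: "`sup_M (|Rm| + |∇Rm|) ≤ C`"). UNCONDITIONAL form of the assembly
`FourShrinker.curvDerivNormSq_one_bounded_of` (`FourShrinkerCovariantCurvatureBoundedOf.lean`): for a
connected `M` modelled on `ℝ⁴`, `g` complete (closed `g`-balls compact) with its Levi-Civita connection,
`f` smooth, `Ric + Hess f = ½ g`, `R + |∇f|² = f`, `R ≤ A`:

* `FourShrinker.curvDerivNormSq_one_bounded` — **`∃ C, |∇Rm|²_g = curvDerivNormSq (𝓡 4) (fun _ ↦ g) 1 0 ≤ C`**.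

The registered inputs of the `_of` theorem are supplied by the Literature theorems
`IsMetricOn.lapAt_rmNormSqAt_sub_fderiv_ge_of_soliton` / `gradSqAt_rmNormSqAt_le` (MW (id) + Kato),
`Shrinker.bounded_of_drift_laplacian_ge_sq` (localised maximum principle),
`IsMetricOn.mw_drift_sqrt_rmNormSqAt_add_normSqAt_ricAt` (drift for `v`),
`IsMetricOn.lapAt_tnormSq_tcov_rm4_sub_fderiv_ge_of_soliton` / `gradSqAt_tnormSq_le` (MW (u1) + Kato, the
rank-generic coordinate calculus), `IsMetricOn.tnormSq_tcov_rm4_eq_sum_sq` /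
`tnormSq_rm4_eq_rmNormSqAt_of_frame` (bridge) and `IsMetricOn.mw_drift_sqrt_covRmNormSq_add_rmNormSqAt`
(drift for `w = √(|∇Rm|²+1) + |Rm|²`), read in the registered shapes (inlined below). With
`FourShrinkerCurvatureBounded.lean` this completes Munteanu–Wang's Thm. 1.4 in the tree — step 1 of the
printed chain behind the named fact `shrinkerSplittingAtInfinity_four`. Everything is proved; no
definition and no statement of `Prop` type is introduced.

## References

* O. Munteanu, J. Wang, *Geometry of shrinking Ricci solitons*, Compositio Math. 151 (2015)
  2273–2300 = arXiv:1410.3813, Thm. 1.4 and its proof (p. 6), Prop. 2.2 / (u1) (p. 7). READ.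
  [MunteanuWang2015]
-/

noncomputable section

set_option maxSynthPendingDepth 3

open Set Filter Module Metric
open scoped Manifold ContDiff Topology NNReal ENNReal

namespace Literature.Geometry.Riemannian

open Lorentzian Lorentzian.PseudoRiemannianMetric

namespace FourShrinker

variable {M : Type} [TopologicalSpace M] [T2Space M] [SecondCountableTopology M]
  [ChartedSpace (EuclideanSpace ℝ (Fin 4)) M] [IsManifold (𝓡 4) ∞ M] [ConnectedSpace M]
  [T3Space M] [MeasurableSpace M] [BorelSpace M]
  (g : PseudoRiemannianMetric (𝓡 4) ∞ (EuclideanSpace ℝ (Fin 4)) (TangentSpace (𝓡 4) : M → Type _))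
  [g.HasLeviCivita] (f : M → ℝ)

/-- **Munteanu–Wang 2015, Thm. 1.4 (second half) — `|∇Rm|` is bounded on a complete four-dimensional
gradient shrinking Ricci soliton with bounded scalar curvature**: for `(M, g, f)` connected, complete
(closed `g`-balls compact), `Ric + Hess f = ½ g`, `R + |∇f|² = f`, `R ≤ A`, there is `C` with
`|∇Rm|²_g = curvDerivNormSq (𝓡 4) (fun _ ↦ g) 1 0 ≤ C` on `M`. [cite: MunteanuWang2015, Thm. 1.4] -/
theorem curvDerivNormSq_one_bounded (hg : g.IsRiemannian)
    (hc : ∀ (x : M) (r : ℝ≥0), IsCompact {y : M | g.edist hg x y ≤ r})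
    (hf : ContMDiff (𝓡 4) 𝓘(ℝ, ℝ) ∞ f)
    (hsol : ∀ (x : M) (X Y : TangentSpace (𝓡 4) x),
      g.ricci x X Y + g.hessian f x X Y = (1 / 2 : ℝ) * g.val x X Y)
    (hnorm : ∀ x : M, g.scalarCurvature x + g.gradSq f x = f x)
    {A : ℝ} (hA : ∀ x : M, g.scalarCurvature x ≤ A) :
    ∃ C : ℝ, ∀ x : M, curvDerivNormSq (𝓡 4) (fun _ ↦ g) 1 0 x ≤ C := by
  -- (S5) the `Rm`-equation in the registered shape
  have hS5 : ∃ C : ℝ, ∀ {E : Type} [NormedAddCommGroup E] [NormedSpace ℝ E]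
      [FiniteDimensional ℝ E] [CompleteSpace E] (G : E → E →L[ℝ] E →L[ℝ] ℝ) (V : Set E) (x : E)
      (f : E → ℝ), MetricCoord.IsMetricOn G V → x ∈ V → Module.finrank ℝ E = 4 →
      (∀ y ∈ V, ∀ v : E, v ≠ 0 → 0 < G y v v) → ContDiffOn ℝ ∞ f V →
      (∀ y ∈ V, ∀ v w : E, MetricCoord.ricAt G y v w + MetricCoord.hessAt G f y v w = (1 / 2 : ℝ) * G y v w) →
      ∃ N : ℝ, 0 ≤ N ∧ 2 * N - C * (Real.sqrt (MetricCoord.rmNormSqAt G x) + 1) * MetricCoord.rmNormSqAt G x ≤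
        MetricCoord.lapAt G (MetricCoord.rmNormSqAt G) x
          - fderiv ℝ (MetricCoord.rmNormSqAt G) x (MetricCoord.sharpAt G x (fderiv ℝ f x)) ∧
        MetricCoord.gradSqAt G (MetricCoord.rmNormSqAt G) x ≤ 4 * MetricCoord.rmNormSqAt G x * N := by
    refine ⟨16 * 4 ^ 6 + 4 * 4 ^ 7, ?_⟩
    intro E _ _ _ _ G V x f hG hx h4 hpos hf hsol
    classical
    obtain ⟨e, he⟩ := MetricCoord.exists_orthonormal_basis (hG.symm x hx) (hpos x hx)
    refine ⟨∑ k, ∑ a, ∑ c, ∑ i, ∑ j,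
      (G x (MetricCoord.covRiemAt G x (e k) (e a) (e c) (e i)) (e j)) ^ 2,
      by positivity, ?_, hG.gradSqAt_rmNormSqAt_le e he hx⟩
    have h := hG.lapAt_rmNormSqAt_sub_fderiv_ge_of_soliton e he hx hf hsol
    have hn : (Fintype.card (Fin (finrank ℝ E)) : ℝ) = 4 := by simp [h4]
    rw [hn] at h
    have hu0 : 0 ≤ MetricCoord.rmNormSqAt G x := hG.rmNormSqAt_nonneg e he hx
    have hK0 : 0 ≤ Real.sqrt (MetricCoord.rmNormSqAt G x) := Real.sqrt_nonneg _
    nlinarith [h, hu0, hK0, mul_nonneg hu0 hK0]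
  -- (S13) the `∇Rm`-equation in the registered shape
  have hS13 : ∃ C : ℝ, ∀ {E : Type} [NormedAddCommGroup E] [NormedSpace ℝ E] [FiniteDimensional ℝ E]
      [CompleteSpace E] (G : E → E →L[ℝ] E →L[ℝ] ℝ) (V : Set E) (x : E) (f : E → ℝ) {ι : Type} [Fintype ι]
      [DecidableEq ι] (b : Module.Basis ι ℝ E), MetricCoord.IsMetricOn G V → x ∈ V → Module.finrank ℝ E = 4 →
      (∀ v : E, v ≠ 0 → 0 < G x v v) → ContDiffOn ℝ ∞ f V →
      (∀ y ∈ V, ∀ v w : E, MetricCoord.ricAt G y v w + MetricCoord.hessAt G f y v w = (1 / 2 : ℝ) * G y v w) →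
      2 * MetricCoord.tnormSq G b (MetricCoord.tcov G b (MetricCoord.tcov G b (MetricCoord.rm4 G b))) x
        + 3 * MetricCoord.tnormSq G b (MetricCoord.tcov G b (MetricCoord.rm4 G b)) x
        - C * (Real.sqrt (MetricCoord.rmNormSqAt G x) + 1) *
          MetricCoord.tnormSq G b (MetricCoord.tcov G b (MetricCoord.rm4 G b)) x ≤
        MetricCoord.lapAt G (MetricCoord.tnormSq G b (MetricCoord.tcov G b (MetricCoord.rm4 G b))) x
          - fderiv ℝ (MetricCoord.tnormSq G b (MetricCoord.tcov G b (MetricCoord.rm4 G b))) x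
              (MetricCoord.sharpAt G x (fderiv ℝ f x)) ∧
      MetricCoord.gradSqAt G (MetricCoord.tnormSq G b (MetricCoord.tcov G b (MetricCoord.rm4 G b))) x ≤
        4 * MetricCoord.tnormSq G b (MetricCoord.tcov G b (MetricCoord.rm4 G b)) x *
          MetricCoord.tnormSq G b (MetricCoord.tcov G b (MetricCoord.tcov G b (MetricCoord.rm4 G b))) x ∧
      0 ≤ MetricCoord.tnormSq G b (MetricCoord.tcov G b (MetricCoord.rm4 G b)) x ∧
      0 ≤ MetricCoord.tnormSq G b (MetricCoord.tcov G b (MetricCoord.tcov G b (MetricCoord.rm4 G b))) x := by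
    refine ⟨84 * 4, ?_⟩
    intro E _ _ _ _ G V x f ι _ _ b hG hx h4 hpos hf hsol
    have hs := hG.symm x hx
    have hcard : (Fintype.card ι : ℝ) = 4 := by
      rw [← Module.finrank_eq_card_basis b, h4]; norm_num
    have hmain := hG.lapAt_tnormSq_tcov_rm4_sub_fderiv_ge_of_soliton b hx hpos hf hsol
    rw [hcard, hG.tnormSq_rm4_eq_rmNormSqAt b hx hpos] at hmain
    have hD1 : 0 ≤ MetricCoord.tnormSq G b (MetricCoord.tcov G b (MetricCoord.rm4 G b)) x :=
      MetricCoord.tnormSq_nonneg b hs hpos _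
    have hD2 : 0 ≤ MetricCoord.tnormSq G b
        (MetricCoord.tcov G b (MetricCoord.tcov G b (MetricCoord.rm4 G b))) x :=
      MetricCoord.tnormSq_nonneg b hs hpos _
    refine ⟨?_, hG.gradSqAt_tnormSq_le b hx hpos (hG.tsmoothOn_tcov (hG.tsmoothOn_rm4 b)), hD1, hD2⟩
    have hK0 : 0 ≤ Real.sqrt (MetricCoord.rmNormSqAt G x) := Real.sqrt_nonneg _
    nlinarith [hmain, hD1, hK0, mul_nonneg hD1 hK0]
  exact curvDerivNormSq_one_bounded_of g f hg hS5
    (fun _ _ _ _ _ _ _ _ _ g' _ _ _ hg' _ _ _ hα hK hf' hu' hsol' hnorm' hR0' hdrift' ↦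
      Shrinker.bounded_of_drift_laplacian_ge_sq g' hg' hα hK hf' hu' hsol' hnorm' hR0' hdrift')
    (fun _ _ _ f b _ _ hG hx hpos _ _ hC hB hRB hq hP hL hN ↦
      hG.mw_drift_sqrt_rmNormSqAt_add_normSqAt_ricAt hx hpos f b hC hB hRB hq hP hL hN)
    hS13
    (by
      intro E _ _ _ _ G V x ι _ _ b e hG hx _ he
      exact ⟨hG.tnormSq_tcov_rm4_eq_sum_sq b hx e he, hG.tnormSq_rm4_eq_rmNormSqAt_of_frame b hx e he⟩)
    (by
      intro E _ _ _ _ G V x f ι _ _ b C₁ C₅ K₀ hG hx hpos _ _ hC₁ hC₅ _ hMK hRm hCov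
      exact hG.mw_drift_sqrt_covRmNormSq_add_rmNormSqAt hx hpos (MetricCoord.sharpAt G x (fderiv ℝ f x)) b
        hC₁ hC₅ hMK hRm hCov.1 hCov.2.1)
    hc hf hsol hnorm hA

end FourShrinker

end Literature.Geometry.Riemannian

end
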